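import Summits.QuantumFields.YangMills.Theorems.BalabanUVNodesN15KingModelComplexLinkNeumann
import HarnessLib
/-!
# BalabanUVNodes ∕ N15 — THE KING-MODEL RUNG (PART Ϛ-d): THE COMPLEX WINDOW IS SHARP — the constant dilated link field `U ≡ V ≡ (1 + m²∕(2(d+1)c))·1` annihilates the constants,
# so `M_{U,V}` is invertible for ALL two-sided fields of norm `≤ 1+ε` IF AND ONLY IF `2(d+1)cε < m²`; the same on PART Ͱ's Hermitian slice; print's `Gᶜ` slice; the neighbourhood form
# (Track A, DAG node N15 = NE2; FAN-OUT v1.1 §N15 s3 «KING-MODEL RUNG … + what the curved case adds»; count-neutral)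
HONEST FRAMING.  Count-neutral (cell `pub-ymgap`, seat `pub-ymgap-dag-n15-e` g43; `--supports stmt-QuantumFields-27247 --as helper` = K3ᴬ, KEY MAP v3).  One finite torus at fixed
spacing; King's `A = 0` model, FINE covariance layer only; nothing of Bałaban's (3.42) ∕ Thm 3.4 for `G(U)` asserted; nothing continuum ∕ ℝ⁴ ∕ OS ∕ Clay; NOT a node discharge.
WHAT IS DECIDED.  [Balaban1985BackgroundPropagators] Thm 3.4 p.400 gives the analytic extension for `α₁ ≤ a₁` with «a positive constant a₁» unspecified («We will assume that α₁ is
sufficiently small», p.400 l.4).  In King's `A = 0` model the admissible size of the complex neighbourhood is decided EXACTLY (PART Ϛ-b `isUnit_cxLapF` gave sufficiency):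
* §1 `cxLapF_scalar_mulVec_const`: at the constant scalar two-sided field `U ≡ a·1`, `V ≡ b·1` the fibre-constant vectors are eigenvectors, `M_{a1,b1}w = (D₀ − (d+1)c(a+b))·w`;
  `norm_ofReal_smul_one_le` (`‖a·1‖_{op} ≤ |a|`);
* §2 ★★★ **`not_isUnit_cxLapF_edge`**: with `ε⋆ = m²∕(2(d+1)c)` (`c > 0`), the field `U ≡ V ≡ (1+ε⋆)·1` — of norm `≤ 1+ε⋆` on every bond — makes `M_{U,V}` SINGULAR (it kills the
  constants: `D₀ − 2(d+1)c(1+ε⋆) = m² − 2(d+1)cε⋆ = 0`); ★★ `exists_not_isUnit_of_le` (every `ε ≥ ε⋆` admits a singular field of norm `≤ 1+ε`);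
  ★★★ **`forall_isUnit_cxLapF_iff`**: for `c > 0`, `m² > 0`, `ε ≥ 0`, nonempty fibre:  (every two-sided field with `‖U(b)‖, ‖V(b)‖ ≤ 1+ε` has `M_{U,V}` invertible) ⟺ `2(d+1)cε < m²`;
* §3 THE HERMITIAN SLICE IS NO BETTER: the edge field is self-adjoint, so ★★ `not_isUnit_covLapF_edge` (PART Ͱ's `−cΔ_U + m²` at the non-unitary `U ≡ (1+ε⋆)·1` is singular) and
  ★★★ **`forall_isUnit_covLapF_iff`**: (every `U` with `‖U(b)‖ ≤ 1+ε` has `covLapF K c m² U` invertible) ⟺ `2(d+1)cε < m²`;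
* §4 PRINT's `Gᶜ` SLICE `V = U⁻¹`: the dilation `U ≡ a·1`, `V ≡ a⁻¹·1` gives `M w = (D₀ − (d+1)c(a + a⁻¹))w` on constants; ★★ `not_isUnit_cxLapF_inv_slice_edge`: it is singular at
  `a♯ = 1+ε⋆+√(ε⋆(2+ε⋆))` (`a♯ + a♯⁻¹ = 2(1+ε⋆)`, `a♯⁻¹ = 1+ε⋆−√(ε⋆(2+ε⋆))`), `edgeDil_gt` (`a♯ > 1+ε⋆`: consistent with Ϛ-b, whose window needs BOTH `‖U‖, ‖U⁻¹‖ ≤ 1+ε`);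
* §5 THE NEIGHBOURHOOD FORM (print's «complex neighbourhood of the space of configurations U»): ★★ **`isUnit_cxLapF_of_near_unitary`** — for a unitary `U₀` and any two-sided field with
  `‖U(b) − U₀(b)‖ ≤ ε`, `‖V(b) − U₀(b)^*‖ ≤ ε` on every bond, `2(d+1)cε < m²`, `M_{U,V}` is invertible with Ϛ-b's domination (`l2_opNorm_blk_cxLapF_inv_le_of_near_unitary`).
PRIOR TREE ART (by name): Ϛ-a (`cxLapF`, `cxLapF_mulVec_apply`, `cxLapF_adjoint`), Ϛ-b (`isUnit_cxLapF`, `l2_opNorm_blk_cxLapF_inv_le`), Ͱ-a (`covLapF`), Ͱ-l (`l2_opNorm_of_mem_unitaryGroup_le`),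
Mathlib (`Matrix.mulVec_injective_iff_isUnit`, `Matrix.l2_opNorm_conjTranspose`, `Real.sqrt`, `Real.mul_self_sqrt`).  Dedup (rg at filing): basename 0 files; needles
`not_isUnit_cxLapF_edge|forall_isUnit_cxLapF_iff|forall_isUnit_covLapF_iff|edgeDil|isUnit_cxLapF_of_near_unitary` 0 tree files.  Locators: [Balaban1985BackgroundPropagators] Thm 3.4
p.400 (l.4 «We will assume that α₁ is sufficiently small»), §3.B p.399 l.37–40, (3.37) p.396; [King1986] (4.4) p.670.  0 `sorry`.
-/

noncomputable section
open scoped BigOperators ComplexConjugate ComplexOrder Matrix.Norms.L2Operator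
open Finset Matrix

namespace Summit.QuantumFields.YangMills.BalabanUVNodes.N15KingModelRung.Covariant

open Literature.MathematicalPhysics.QuantumFieldTheory.LatticeDiamagneticInequality (Hopping blk)
open Literature.MathematicalPhysics.QuantumFieldTheory.Balaban1983to89.B5Prop11Plancherel (Tor unitVec)
open Literature.MathematicalPhysics.QuantumFieldTheory.King1986.Torus (lapF)

variable {d : ℕ} (K : Fin (d + 1) → ℕ) [hK : ∀ μ, NeZero (K μ)]
variable {𝕜 : Type*} [RCLike 𝕜] {n : Type*} [Fintype n] [DecidableEq n] {c m2 ε : ℝ}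

/-- THE EDGE OF THE WINDOW: `ε⋆ = m²∕(2(d+1)c)`. [cite: Balaban1985BackgroundPropagators, Thm 3.4 p.400] -/
def edgeEps (d : ℕ) (c m2 : ℝ) : ℝ := m2 / (2 * ((d : ℝ) + 1) * c)

/-- THE SINGULAR DILATION OF PRINT's `Gᶜ` SLICE: `a♯ = 1 + ε⋆ + √(ε⋆(2+ε⋆))`, the larger root of `a + a⁻¹ = 2(1+ε⋆)`. [cite: Balaban1985BackgroundPropagators, §3.B p.399 l.37–40] -/
def edgeDil (d : ℕ) (c m2 : ℝ) : ℝ := 1 + edgeEps d c m2 + Real.sqrt (edgeEps d c m2 * (2 + edgeEps d c m2))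

/-! ## §1 Constant scalar link fields act diagonally on fibre-constant vectors -/

/-- AT A CONSTANT SCALAR TWO-SIDED FIELD `U ≡ a·1`, `V ≡ b·1` the vectors constant along the torus are eigenvectors: `M_{a1,b1}w = (D₀ − (d+1)c(a+b))·w` for `w(x,i) = w₀(i)`
(each of the `d+1` directions contributes `c(a+b)`). [cite: King1986, (4.4) p.670; Balaban1985BackgroundPropagators, (3.23) p.394] -/
theorem cxLapF_scalar_mulVec_const (c m2 : ℝ) (a b : 𝕜) (w₀ : n → 𝕜) :
    cxLapF K c m2 (fun _ => a • (1 : Matrix n n 𝕜)) (fun _ => b • (1 : Matrix n n 𝕜)) *ᵥ (fun p : Tor K × n => w₀ p.2)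
      = ((((m2 + 2 * ((d : ℝ) + 1) * c : ℝ) : 𝕜)) - ((d : 𝕜) + 1) * (c : 𝕜) * (a + b)) • (fun p : Tor K × n => w₀ p.2) := by
  funext p
  obtain ⟨x, i⟩ := p
  rw [cxLapF_mulVec_apply, Pi.smul_apply, smul_eq_mul]
  simp only [Matrix.smul_mulVec, Matrix.one_mulVec, Pi.smul_apply, smul_eq_mul, Finset.sum_const, Finset.card_univ, Fintype.card_fin,
    nsmul_eq_mul]
  push_cast
  ring

omit hK in
/-- `‖a·1‖_{op} ≤ |a|` for a real scalar `a` (the identity is unitary, Ͱ-l `l2_opNorm_of_mem_unitaryGroup_le`). [folklore] -/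
theorem norm_ofReal_smul_one_le (a : ℝ) : ‖((a : 𝕜)) • (1 : Matrix n n 𝕜)‖ ≤ |a| := by
  rw [norm_smul, RCLike.norm_ofReal]
  exact mul_le_of_le_one_right (abs_nonneg a) (l2_opNorm_of_mem_unitaryGroup_le (Submonoid.one_mem _))

/-- `ε⋆ ≥ 0`. [folklore] -/
theorem edgeEps_nonneg (hc : 0 ≤ c) (hm : 0 ≤ m2) : 0 ≤ edgeEps d c m2 := by
  unfold edgeEps; positivity

/-- `2(d+1)c·ε⋆ = m²` (`c > 0`). [folklore] -/
theorem window_mul_edgeEps (hc : 0 < c) (m2 : ℝ) : 2 * ((d : ℝ) + 1) * c * edgeEps d c m2 = m2 := by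
  unfold edgeEps
  have h : 2 * ((d : ℝ) + 1) * c ≠ 0 := by positivity
  field_simp

/-- THE EDGE FIELD HAS NORM `≤ 1+ε⋆` on every bond. [folklore] -/
theorem norm_edge_le (hc : 0 ≤ c) (hm : 0 ≤ m2) : ‖(((1 + edgeEps d c m2 : ℝ) : 𝕜)) • (1 : Matrix n n 𝕜)‖ ≤ 1 + edgeEps d c m2 :=
  (norm_ofReal_smul_one_le (𝕜 := 𝕜) (n := n) _).trans (le_of_eq (abs_of_nonneg (by have := edgeEps_nonneg (d := d) hc hm; linarith)))

/-! ## §2 The two-sided window is sharp -/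

/-- ★★★ **THE EDGE FIELD IS SINGULAR**: for `c > 0`, `m² > 0`, nonempty fibre, `M_{U,V}` at `U ≡ V ≡ (1+ε⋆)·1`, `ε⋆ = m²∕(2(d+1)c)`, is NOT invertible — it annihilates every
fibre-constant vector (`D₀ − 2(d+1)c(1+ε⋆) = m² − 2(d+1)cε⋆ = 0`). [cite: Balaban1985BackgroundPropagators, Thm 3.4 p.400; King1986, (4.4) p.670] -/
theorem not_isUnit_cxLapF_edge [Nonempty n] (hc : 0 < c) (m2 : ℝ) :
    ¬ IsUnit (cxLapF K c m2 (fun _ : Tor K × Fin (d + 1) => (((1 + edgeEps d c m2 : ℝ) : 𝕜)) • (1 : Matrix n n 𝕜))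
      (fun _ => (((1 + edgeEps d c m2 : ℝ) : 𝕜)) • (1 : Matrix n n 𝕜))) := by
  intro hU
  have hinj := Matrix.mulVec_injective_iff_isUnit.mpr hU
  have hfac : ((((m2 + 2 * ((d : ℝ) + 1) * c : ℝ) : 𝕜)) - ((d : 𝕜) + 1) * (c : 𝕜) * ((((1 + edgeEps d c m2 : ℝ) : 𝕜)) + (((1 + edgeEps d c m2 : ℝ) : 𝕜)))) = 0 := by
    have hℝ : m2 + 2 * ((d : ℝ) + 1) * c - ((d : ℝ) + 1) * c * ((1 + edgeEps d c m2) + (1 + edgeEps d c m2)) = 0 := by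
      have := window_mul_edgeEps (d := d) hc m2; linarith
    have hcast : ((((m2 + 2 * ((d : ℝ) + 1) * c : ℝ) : 𝕜)) - ((d : 𝕜) + 1) * (c : 𝕜) * ((((1 + edgeEps d c m2 : ℝ) : 𝕜)) + (((1 + edgeEps d c m2 : ℝ) : 𝕜))))
        = ((m2 + 2 * ((d : ℝ) + 1) * c - ((d : ℝ) + 1) * c * ((1 + edgeEps d c m2) + (1 + edgeEps d c m2)) : ℝ) : 𝕜) := by push_cast; ring
    rw [hcast, hℝ, RCLike.ofReal_zero]
  have hker : cxLapF K c m2 (fun _ : Tor K × Fin (d + 1) => (((1 + edgeEps d c m2 : ℝ) : 𝕜)) • (1 : Matrix n n 𝕜))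
      (fun _ => (((1 + edgeEps d c m2 : ℝ) : 𝕜)) • (1 : Matrix n n 𝕜)) *ᵥ (fun _ : Tor K × n => (1 : 𝕜)) = 0 := by
    have h := cxLapF_scalar_mulVec_const K c m2 (((1 + edgeEps d c m2 : ℝ) : 𝕜)) (((1 + edgeEps d c m2 : ℝ) : 𝕜)) (fun _ : n => (1 : 𝕜))
    rw [hfac, zero_smul] at h
    exact h
  have h0 : (fun _ : Tor K × n => (1 : 𝕜)) = 0 := hinj (by rw [hker, Matrix.mulVec_zero])
  obtain ⟨i⟩ := ‹Nonempty n›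
  have := congr_fun h0 ((0 : Tor K), i)
  exact one_ne_zero this

/-- ★★ EVERY `ε` AT OR BEYOND THE EDGE ADMITS A SINGULAR FIELD OF NORM `≤ 1+ε` (the edge field). [cite: Balaban1985BackgroundPropagators, Thm 3.4 p.400] -/
theorem exists_not_isUnit_of_le [Nonempty n] (hc : 0 < c) (hm : 0 < m2) (hle : m2 ≤ 2 * ((d : ℝ) + 1) * c * ε) :
    ∃ U V : Tor K × Fin (d + 1) → Matrix n n 𝕜, (∀ b, ‖U b‖ ≤ 1 + ε) ∧ (∀ b, ‖V b‖ ≤ 1 + ε) ∧ ¬ IsUnit (cxLapF K c m2 U V) := by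
  have hεle : edgeEps d c m2 ≤ ε := by
    unfold edgeEps
    rw [div_le_iff₀ (by positivity)]
    linarith
  refine ⟨fun _ => (((1 + edgeEps d c m2 : ℝ) : 𝕜)) • 1, fun _ => (((1 + edgeEps d c m2 : ℝ) : 𝕜)) • 1, fun b => ?_, fun b => ?_,
    not_isUnit_cxLapF_edge K hc m2⟩
  · exact (norm_edge_le hc.le hm.le).trans (by linarith)
  · exact (norm_edge_le hc.le hm.le).trans (by linarith)

/-- ★★★ **THE TWO-SIDED COMPLEX WINDOW IS SHARP**: for `c > 0`, `m² > 0`, `ε ≥ 0` and a nonempty fibre,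
(for ALL two-sided link fields with `‖U(b)‖, ‖V(b)‖ ≤ 1+ε` the operator `M_{U,V}` is invertible) ⟺ `2(d+1)c·ε < m²`.  Print's «a positive constant a₁» is, in the model, EXACTLY
`m²∕(2(d+1)c)` in the operator-norm polydisc. [cite: Balaban1985BackgroundPropagators, Thm 3.4 p.400; King1986, (4.4) p.670] -/
theorem forall_isUnit_cxLapF_iff [Nonempty n] (hc : 0 < c) (hm : 0 < m2) (hε : 0 ≤ ε) :
    (∀ U V : Tor K × Fin (d + 1) → Matrix n n 𝕜, (∀ b, ‖U b‖ ≤ 1 + ε) → (∀ b, ‖V b‖ ≤ 1 + ε) → IsUnit (cxLapF K c m2 U V))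
      ↔ 2 * ((d : ℝ) + 1) * c * ε < m2 := by
  constructor
  · intro h
    by_contra hle
    obtain ⟨U, V, hU, hV, hnot⟩ := exists_not_isUnit_of_le K (𝕜 := 𝕜) (n := n) hc hm (not_lt.mp hle)
    exact hnot (h U V hU hV)
  · intro hwin U V hU hV
    exact isUnit_cxLapF K hc.le hm hε hwin hU hV

/-! ## §3 The Hermitian slice is no better -/

omit hK [Fintype n] in
/-- The edge field is self-adjoint bondwise: `((1+ε⋆)·1)ᴴ = (1+ε⋆)·1`. [folklore] -/
theorem edge_conjTranspose (a : ℝ) : (((a : 𝕜)) • (1 : Matrix n n 𝕜))ᴴ = ((a : 𝕜)) • (1 : Matrix n n 𝕜) := by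
  rw [conjTranspose_smul, conjTranspose_one, RCLike.star_def, RCLike.conj_ofReal]

/-- ★★ **PART Ͱ's HERMITIAN FAMILY AT THE EDGE IS SINGULAR**: `−cΔ_U + m²` at the non-unitary self-adjoint field `U ≡ (1+ε⋆)·1` is not invertible.
[cite: Balaban1985BackgroundPropagators, (3.23) p.394, Thm 3.4 p.400; King1986, (4.4) p.670] -/
theorem not_isUnit_covLapF_edge [Nonempty n] (hc : 0 < c) (m2 : ℝ) :
    ¬ IsUnit (covLapF K c m2 (fun _ : Tor K × Fin (d + 1) => (((1 + edgeEps d c m2 : ℝ) : 𝕜)) • (1 : Matrix n n 𝕜))) := by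
  have h := not_isUnit_cxLapF_edge K (𝕜 := 𝕜) (n := n) hc m2
  have key : cxLapF K c m2 (fun _ : Tor K × Fin (d + 1) => (((1 + edgeEps d c m2 : ℝ) : 𝕜)) • (1 : Matrix n n 𝕜))
        (fun b => ((fun _ : Tor K × Fin (d + 1) => (((1 + edgeEps d c m2 : ℝ) : 𝕜)) • (1 : Matrix n n 𝕜)) b)ᴴ)
      = cxLapF K c m2 (fun _ : Tor K × Fin (d + 1) => (((1 + edgeEps d c m2 : ℝ) : 𝕜)) • (1 : Matrix n n 𝕜))
        (fun _ => (((1 + edgeEps d c m2 : ℝ) : 𝕜)) • (1 : Matrix n n 𝕜)) := by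
    congr 1; funext b; exact edge_conjTranspose _
  rw [← cxLapF_adjoint, key]
  exact h

/-- ★★★ **THE HERMITIAN WINDOW IS SHARP TOO**: (for ALL link fields with `‖U(b)‖ ≤ 1+ε` PART Ͱ's `−cΔ_U + m²` is invertible) ⟺ `2(d+1)c·ε < m²` (`c > 0`, `m² > 0`, `ε ≥ 0`,
nonempty fibre).  Off the unitary fields, positivity of `m²` alone does not protect `−cΔ_U + m²`. [cite: Balaban1985BackgroundPropagators, Thm 3.4 p.400; King1986, (4.4) p.670] -/
theorem forall_isUnit_covLapF_iff [Nonempty n] (hc : 0 < c) (hm : 0 < m2) (hε : 0 ≤ ε) :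
    (∀ U : Tor K × Fin (d + 1) → Matrix n n 𝕜, (∀ b, ‖U b‖ ≤ 1 + ε) → IsUnit (covLapF K c m2 U)) ↔ 2 * ((d : ℝ) + 1) * c * ε < m2 := by
  constructor
  · intro h
    by_contra hle
    have hεle : edgeEps d c m2 ≤ ε := by
      unfold edgeEps
      rw [div_le_iff₀ (by positivity)]
      linarith [not_lt.mp hle]
    refine not_isUnit_covLapF_edge K (𝕜 := 𝕜) (n := n) hc m2 (h _ fun b => ?_)
    exact (norm_edge_le hc.le hm.le).trans (by linarith)
  · intro hwin U hU
    rw [← cxLapF_adjoint]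
    exact isUnit_cxLapF K hc.le hm hε hwin hU (fun b => by rw [Matrix.l2_opNorm_conjTranspose]; exact hU b)

/-! ## §4 Print's `Gᶜ` slice `V = U⁻¹`: the singular dilation `a♯` -/

/-- `ε⋆(2+ε⋆) ≥ 0`. [folklore] -/
theorem edgeEps_mul_nonneg (hc : 0 ≤ c) (hm : 0 ≤ m2) : 0 ≤ edgeEps d c m2 * (2 + edgeEps d c m2) := by
  have := edgeEps_nonneg (d := d) hc hm; positivity

/-- VIETA: `a♯ · (1+ε⋆−√(ε⋆(2+ε⋆))) = 1`. [folklore] -/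
theorem edgeDil_mul_conj (hc : 0 ≤ c) (hm : 0 ≤ m2) :
    edgeDil d c m2 * (1 + edgeEps d c m2 - Real.sqrt (edgeEps d c m2 * (2 + edgeEps d c m2))) = 1 := by
  unfold edgeDil
  have h := Real.mul_self_sqrt (edgeEps_mul_nonneg (d := d) hc hm)
  nlinarith [h]

/-- `a♯ > 0`. [folklore] -/
theorem edgeDil_pos (hc : 0 ≤ c) (hm : 0 ≤ m2) : 0 < edgeDil d c m2 := by
  unfold edgeDil
  have := edgeEps_nonneg (d := d) hc hm
  have := Real.sqrt_nonneg (edgeEps d c m2 * (2 + edgeEps d c m2))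
  linarith

/-- `a♯⁻¹ = 1+ε⋆−√(ε⋆(2+ε⋆))`. [folklore] -/
theorem edgeDil_inv (hc : 0 ≤ c) (hm : 0 ≤ m2) :
    (edgeDil d c m2)⁻¹ = 1 + edgeEps d c m2 - Real.sqrt (edgeEps d c m2 * (2 + edgeEps d c m2)) := by
  have h := edgeDil_mul_conj (d := d) hc hm
  have hpos := edgeDil_pos (d := d) hc hm
  field_simp
  linarith [h]

/-- VIETA: `a♯ + a♯⁻¹ = 2(1+ε⋆)`. [folklore] -/
theorem edgeDil_add_inv (hc : 0 ≤ c) (hm : 0 ≤ m2) : edgeDil d c m2 + (edgeDil d c m2)⁻¹ = 2 * (1 + edgeEps d c m2) := by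
  rw [edgeDil_inv hc hm]; unfold edgeDil; ring

/-- `a♯ > 1 + ε⋆` when `m² > 0` (so `(a♯·1, a♯⁻¹·1)` lies OUTSIDE Ϛ-b's two-sided window of radius `1+ε⋆`, as it must). [folklore] -/
theorem edgeDil_gt (hc : 0 < c) (hm : 0 < m2) : 1 + edgeEps d c m2 < edgeDil d c m2 := by
  unfold edgeDil
  have hε : 0 < edgeEps d c m2 := by unfold edgeEps; positivity
  have : 0 < Real.sqrt (edgeEps d c m2 * (2 + edgeEps d c m2)) := Real.sqrt_pos.mpr (by positivity)
  linarith

/-- ★★ **PRINT's `Gᶜ` SLICE BECOMES SINGULAR AT THE DILATION `a♯`**: at `U ≡ a♯·1`, `V = U⁻¹ ≡ a♯⁻¹·1` the operator `M_{U,U⁻¹}` kills the constants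
(`D₀ − (d+1)c(a♯ + a♯⁻¹) = m² − 2(d+1)cε⋆ = 0`), `c > 0`, nonempty fibre. [cite: Balaban1985BackgroundPropagators, §3.B p.399 l.37–40, Thm 3.4 p.400] -/
theorem not_isUnit_cxLapF_inv_slice_edge [Nonempty n] (hc : 0 < c) (hm : 0 < m2) :
    ¬ IsUnit (cxLapF K c m2 (fun _ : Tor K × Fin (d + 1) => (((edgeDil d c m2 : ℝ) : 𝕜)) • (1 : Matrix n n 𝕜))
      (fun _ => ((((edgeDil d c m2)⁻¹ : ℝ) : 𝕜)) • (1 : Matrix n n 𝕜))) := by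
  intro hU
  have hinj := Matrix.mulVec_injective_iff_isUnit.mpr hU
  have hfac : ((((m2 + 2 * ((d : ℝ) + 1) * c : ℝ) : 𝕜)) - ((d : 𝕜) + 1) * (c : 𝕜) * ((((edgeDil d c m2 : ℝ) : 𝕜)) + ((((edgeDil d c m2)⁻¹ : ℝ) : 𝕜)))) = 0 := by
    have hℝ : m2 + 2 * ((d : ℝ) + 1) * c - ((d : ℝ) + 1) * c * (edgeDil d c m2 + (edgeDil d c m2)⁻¹) = 0 := by
      rw [edgeDil_add_inv hc.le hm.le]
      have := window_mul_edgeEps (d := d) hc m2; linarith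
    have hcast : ((((m2 + 2 * ((d : ℝ) + 1) * c : ℝ) : 𝕜)) - ((d : 𝕜) + 1) * (c : 𝕜) * ((((edgeDil d c m2 : ℝ) : 𝕜)) + ((((edgeDil d c m2)⁻¹ : ℝ) : 𝕜))))
        = ((m2 + 2 * ((d : ℝ) + 1) * c - ((d : ℝ) + 1) * c * (edgeDil d c m2 + (edgeDil d c m2)⁻¹) : ℝ) : 𝕜) := by push_cast; ring
    rw [hcast, hℝ, RCLike.ofReal_zero]
  have hker : cxLapF K c m2 (fun _ : Tor K × Fin (d + 1) => (((edgeDil d c m2 : ℝ) : 𝕜)) • (1 : Matrix n n 𝕜))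
      (fun _ => ((((edgeDil d c m2)⁻¹ : ℝ) : 𝕜)) • (1 : Matrix n n 𝕜)) *ᵥ (fun _ : Tor K × n => (1 : 𝕜)) = 0 := by
    have h := cxLapF_scalar_mulVec_const K c m2 (((edgeDil d c m2 : ℝ) : 𝕜)) ((((edgeDil d c m2)⁻¹ : ℝ) : 𝕜)) (fun _ : n => (1 : 𝕜))
    rw [hfac, zero_smul] at h
    exact h
  have h0 : (fun _ : Tor K × n => (1 : 𝕜)) = 0 := hinj (by rw [hker, Matrix.mulVec_zero])
  obtain ⟨i⟩ := ‹Nonempty n›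
  exact one_ne_zero (congr_fun h0 ((0 : Tor K), i))

omit hK in
/-- On the `Gᶜ` slice the backward transporter of the dilation `a·1` IS `(a·1)⁻¹ = a⁻¹·1` (`a ≠ 0`). [folklore] -/
theorem smul_one_inv {a : ℝ} (ha : a ≠ 0) : (((a : 𝕜)) • (1 : Matrix n n 𝕜))⁻¹ = (((a⁻¹ : ℝ) : 𝕜)) • (1 : Matrix n n 𝕜) := by
  have ha' : ((a : 𝕜)) ≠ 0 := by rwa [Ne, RCLike.ofReal_eq_zero]
  refine Matrix.inv_eq_left_inv ?_
  rw [smul_mul_smul_comm, Matrix.one_mul, RCLike.ofReal_inv, inv_mul_cancel₀ ha', one_smul]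

/-! ## §5 The neighbourhood form -/

omit hK in
/-- A field within `ε` of a unitary field (bondwise, operator norm) lies in the polydisc of radius `1+ε`. [folklore] -/
theorem norm_le_of_near_unitary {U₀ U : Tor K × Fin (d + 1) → Matrix n n 𝕜} (hU₀ : ∀ b, U₀ b ∈ Matrix.unitaryGroup n 𝕜)
    (hU : ∀ b, ‖U b - U₀ b‖ ≤ ε) (b : Tor K × Fin (d + 1)) : ‖U b‖ ≤ 1 + ε := by
  have h := norm_add_le (U₀ b) (U b - U₀ b)
  rw [add_sub_cancel] at h
  exact h.trans (add_le_add (l2_opNorm_of_mem_unitaryGroup_le (hU₀ b)) (hU b))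

omit hK in
/-- Same for the backward field near `U₀^*`. [folklore] -/
theorem norm_le_of_near_unitary_adjoint {U₀ V : Tor K × Fin (d + 1) → Matrix n n 𝕜} (hU₀ : ∀ b, U₀ b ∈ Matrix.unitaryGroup n 𝕜)
    (hV : ∀ b, ‖V b - (U₀ b)ᴴ‖ ≤ ε) (b : Tor K × Fin (d + 1)) : ‖V b‖ ≤ 1 + ε := by
  have h := norm_add_le ((U₀ b)ᴴ) (V b - (U₀ b)ᴴ)
  rw [add_sub_cancel] at h
  refine h.trans (add_le_add ?_ (hV b))
  rw [Matrix.l2_opNorm_conjTranspose]; exact l2_opNorm_of_mem_unitaryGroup_le (hU₀ b)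

/-- ★★ **THE NEIGHBOURHOOD FORM OF THE WINDOW** (print's «complex neighbourhood of the space of configurations U»): for a unitary `U₀`, every two-sided field with
`‖U(b) − U₀(b)‖ ≤ ε` and `‖V(b) − U₀(b)^*‖ ≤ ε` on all bonds, `2(d+1)cε < m²`, has `M_{U,V}` invertible. [cite: Balaban1985BackgroundPropagators, §3.B p.399 l.40 – p.400 l.3, Thm 3.4 p.400] -/
theorem isUnit_cxLapF_of_near_unitary (hc : 0 ≤ c) (hm : 0 < m2) (hε : 0 ≤ ε) (hwin : 2 * ((d : ℝ) + 1) * c * ε < m2)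
    {U₀ U V : Tor K × Fin (d + 1) → Matrix n n 𝕜} (hU₀ : ∀ b, U₀ b ∈ Matrix.unitaryGroup n 𝕜)
    (hU : ∀ b, ‖U b - U₀ b‖ ≤ ε) (hV : ∀ b, ‖V b - (U₀ b)ᴴ‖ ≤ ε) : IsUnit (cxLapF K c m2 U V) :=
  isUnit_cxLapF K hc hm hε hwin (norm_le_of_near_unitary K hU₀ hU) (norm_le_of_near_unitary_adjoint K hU₀ hV)

/-- ★★ … with Ϛ-b's DOMINATION AT THE SHIFTED PARAMETERS: `‖(G_{U,V})_{xy}‖_{op} ≤ (lapF K ((1+ε)c) (m²−2(d+1)cε))⁻¹(x,y)` on that neighbourhood.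
[cite: Balaban1985BackgroundPropagators, Thm 3.4 p.400, (3.42) p.397] -/
theorem l2_opNorm_blk_cxLapF_inv_le_of_near_unitary (hc : 0 ≤ c) (hm : 0 < m2) (hε : 0 ≤ ε) (hwin : 2 * ((d : ℝ) + 1) * c * ε < m2)
    {U₀ U V : Tor K × Fin (d + 1) → Matrix n n 𝕜} (hU₀ : ∀ b, U₀ b ∈ Matrix.unitaryGroup n 𝕜)
    (hU : ∀ b, ‖U b - U₀ b‖ ≤ ε) (hV : ∀ b, ‖V b - (U₀ b)ᴴ‖ ≤ ε) (x y : Tor K) :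
    ‖blk (cxLapF K c m2 U V)⁻¹ x y‖ ≤ (lapF K ((1 + ε) * c) (m2 - 2 * ((d : ℝ) + 1) * c * ε))⁻¹ x y :=
  l2_opNorm_blk_cxLapF_inv_le K hc hm hε hwin (norm_le_of_near_unitary K hU₀ hU) (norm_le_of_near_unitary_adjoint K hU₀ hV) x y

end Summit.QuantumFields.YangMills.BalabanUVNodes.N15KingModelRung.Covariant

end
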